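import Mathlib
import HarnessLib
import Summits.Parity.GeneralizedHardyLittlewood.Theses.LeeYangFibres
import Summits.Parity.GeneralizedHardyLittlewood.Theorems.ModelHyperbolicity.Negative.ModelHyperbolicityUniformFalse

/-!
# Line `delay-ladder-sturm-chain` — checked skeleton for crux `ModelHyperbolicity` (stmt-Parity-14110)

Crux (route `LeeYangFibres`, rank 4, VERBATIM; factored as in the landed Negative file
`ModelHyperbolicityLoadBearing`: `ModelHyperbolicity ↔ ∀ u ≥ 2, ∃ x₀, ∀ x ≥ x₀, RealRootedAt u x`,
`crux_iff` by `Iff.rfl`): for every `u ≥ 2` and all large `x` the rough-integer cell polynomial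
`P_{u,x}(z) = Σ_{j ≤ u} A_j(x) z^j`, `A_j(x) = cell u x j = #{n ≤ x : x^{1/u} < P⁻(n), Ω(n) = j}`,
has only real zeros.

## The line (idea `delay-ladder-sturm-chain`, merged by all three triagers with `delay-sturm-interlacing`)

Objects. Buchstab–Dickman–Alladi cell densities `I_j = cellDensity j`:
`I_1(u) = 1 (u ≥ 1), I_j(u) = ∫_1^{u-1} I_{j-1}(t) dt/t`, so `I_j(u) = 0` for `u ≤ j` (`j ≥ 2`) and
`∂_u I_j(u) = I_{j-1}(u-1)/(u-1)` (`u > 2`). The DELAY LADDER is the two-index family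
`G_N(t;ζ) = modelG N ζ t = Σ_{j<N} I_{j+1}(t) ζ^j` with the ladder identity
`∂_t G_{N+1}(t;ζ) = ζ · G_N(t-1;ζ)/(t-1)` (`t > 2`) and `G_{N+1}(t;·) = G_N(t;·)` for `t ≤ N+1`;
at an integer `u ≥ 2` the limit cell polynomial is `G(u;ζ) = G_{u-1}(u;ζ) = Σ_{j=1}^{u-1} I_j(u) ζ^{j-1}`
(degree `u-2`, leading coefficient `I_{u-1}(u) > 0`), and `A_j(x) log x / x → I_j(u)` (Alladi).

Chain of lemmas (`stub_*` below; sizes are guesses; the composition is kernel-checked):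
* `stub_delay`  (M)  calculus of `I_j` + the ladder identity (FTC on the recursion).
* `stub_gap`    (M)  DELAY ⟹ GAP: for `ζ < 0`, two zeros `1 ≤ s < t ≤ N+1` of `t ↦ G_N(t;ζ)` are MORE
  than `1` apart (method of steps: after a zero, `G_N(·-1)` has one sign on the next unit interval, so
  `G_N` is strictly monotone there; abstract version machine-checked by triager r1-1, `GapLemma.lean`,
  evidence on the item). Consequence: `G(u;·)` and `G(u-1;·)` never share a zero.
* `stub_chain`  (L, HARDEST) DELAY ⟹ GAP ⟹ ALTERNATION: the Sturm chain along the ladder — on each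
  `u ∈ (m, m+1]` the zeros of `G_m(u;·)` (degree `m-1`) and of `G_m(u-1;·) = G_{m-1}(u-1;·)` (degree
  `m-2`) are real, simple, negative and STRICTLY INTERLACED; open (fixed degrees, positive leading
  coefficients `I_m(u)`, `I_{m-1}(u-1)`), closed from the left (a loss of strictness is a shared zero
  `ζ < 0`, i.e. two zeros of `t ↦ G_m(t;ζ)` at distance exactly `1` — excluded by GAP), births at
  integers ordered by `I_m(m+δ) ≤ δ·I_{m-1}(m-1+δ)/(m-1)`; base `(2,3]`: `G = 1 + log(u-1)ζ`. Output used
  downstream, at integer `u ≥ 2` only: `u-1` strictly decreasing test points with `(-1)^i G(u;q_i) > 0`.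
* `stub_asymptotics` (L) Alladi's cell asymptotics `A_j(x) log x/x → I_j(u)` (`1 ≤ j < u`, fixed `u`;
  induction on `j` over Buchstab's identity + PNT, template `RoughNumbersBuchstabStep.lean`).
* `stub_transfer` (M) finite-`x` algebra: strict sign alternation of the reduced real cell polynomial
  `Q_{u,x}(q) = cellQ u x q = Σ_{j<u-1} A_{j+1}(x) q^j` at `u-1` strictly decreasing points ⟹
  `RealRootedAt u x` (`A_0 = A_u = 0`, IVT count, degree `≤ u-2`; cf. the standing disprover's §F
  `realRootedAt_of_alternating`, sorry-free in `Cruxes/ModelHyperbolicity/Disproof.lean`).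
* `realRooted_of_stubs` (PROVED here): ALTERNATION + ASYMPTOTICS + TRANSFER ⟹ `∀ u ≥ 2, ∃ x₀, ∀ x ≥ x₀,
  RealRootedAt u x` — the scaled polynomial `(log x/x)·Q_{u,x}(q_i)` tends to `G(u;q_i)`, so the `u-1`
  signs are eventually the model signs (finite intersection of eventualities), then TRANSFER.
* `ModelHyperbolicity_of : ModelHyperbolicity` — the composition, concluding the crux BY NAME
  (`crux_iff.mpr`); its only `sorry`s are the five stubs.

Disproof.lean honoured (gen-2 tree file, read 2026-08-16T00:05Z): `modelHyperbolicity_false_without_largeX`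
— the line USES "large x": `x₀(u)` is produced in `realRooted_of_stubs` from the limits of
`stub_asymptotics`, per `u`; `not_modelHyperbolicityUniform` — `x₀` depends on `u` (no uniform claim
anywhere); `modelHyperbolicity_false_without_two_le` — `2 ≤ u` is carried by ALTERNATION/TRANSFER
(`stub_transfer` at `u = 1` would be false: `not_realRootedAt_one`); `not_monotone_in_x` — no stub
inherits real-rootedness from smaller `x`. No stub is an instance of a landed `Negative/*` lemma.
-/

namespace Summit.Parity.GeneralizedHardyLittlewood.Cruxes.ModelHyperbolicity.DelayLadderSturmChain

open Summit.Parity.GeneralizedHardyLittlewood.Theses.LeeYangFibres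
open Summit.Parity.GeneralizedHardyLittlewood.Theorems.ModelHyperbolicity.Negative
open Filter Topology

noncomputable section

/-! ## §0 Objects (definitions only; a stub worker copies this section verbatim, or the lead lands it
first as a sorry-free objects file and everybody imports it) -/

/-- Buchstab–Dickman–Alladi cell densities `I_j(u)`: `I_0 = 0`, `I_1(u) = 1` for `u ≥ 1` (else `0`),
`I_{j+2}(u) = ∫_1^{u-1} I_{j+1}(t) dt/t`. Heuristic/theorem (Alladi 1982): `A_j(x) ~ I_j(u)·x/log x`;
`Σ_j I_j(u) = u·ω(u)` (Buchstab). -/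
def cellDensity : ℕ → ℝ → ℝ
  | 0, _ => 0
  | 1, u => if 1 ≤ u then 1 else 0
  | (j + 2), u => ∫ t in (1 : ℝ)..(u - 1), cellDensity (j + 1) t / t

/-- The delay ladder `G_N(t;ζ) = Σ_{j<N} I_{j+1}(t) ζ^j`; at an integer `u ≥ 2` the limit cell
polynomial `G(u;ζ) = Σ_{j=1}^{u-1} I_j(u) ζ^{j-1}` is `modelG (u-1) ζ u`. -/
def modelG (N : ℕ) (ζ t : ℝ) : ℝ := ∑ j ∈ Finset.range N, cellDensity (j + 1) t * ζ ^ j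

/-- The reduced finite-`x` cell polynomial at a real point, `Q_{u,x}(q) = Σ_{j<u-1} A_{j+1}(x) q^j`
(`P_{u,x}(z) = z·Q_{u,x}(z)` because `A_0 = A_u = 0`). -/
def cellQ (u x : ℕ) (q : ℝ) : ℝ := ∑ j ∈ Finset.range (u - 1), (cell u x (j + 1) : ℝ) * q ^ j

/-! ## §1 Registered stubs (the ONLY sorries of this file) -/

/-- STUB `stub_delay` (M) — calculus of the cell densities and the LADDER IDENTITY:
(D1) `I_j(t) = 0` for `t ≤ j`, `j ≥ 2`; (D2) `I_j(t) > 0` for `t > j`, `j ≥ 1`; (D3) `I_j` continuous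
(`j ≥ 2`); (D4) `I_{j+1}'(t) = I_j(t-1)/(t-1)` for `t > 2` (FTC at `t-1 > 1`, where the integrand is
continuous); (D5) `∂_t G_{N+1}(t;ζ) = ζ·G_N(t-1;ζ)/(t-1)` for `t > 2` (sum of (D4), `I_1` locally
constant). -/
theorem stub_delay :
    (∀ j : ℕ, 2 ≤ j → ∀ t : ℝ, t ≤ j → cellDensity j t = 0) ∧
    (∀ j : ℕ, 1 ≤ j → ∀ t : ℝ, (j : ℝ) < t → 0 < cellDensity j t) ∧
    (∀ j : ℕ, 2 ≤ j → Continuous (cellDensity j)) ∧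
    (∀ j : ℕ, 1 ≤ j → ∀ t : ℝ, 2 < t →
      HasDerivAt (cellDensity (j + 1)) (cellDensity j (t - 1) / (t - 1)) t) ∧
    (∀ N : ℕ, ∀ ζ t : ℝ, 2 < t →
      HasDerivAt (modelG (N + 1) ζ) (ζ * modelG N ζ (t - 1) / (t - 1)) t) := by
  sorry

/-- STUB `stub_gap` (M) — the DELAY-LADDER GAP LEMMA (bounded horizon `N+1`): for `ζ < 0` and `N ≥ 1`,
two zeros `1 ≤ s < t ≤ N+1` of `t ↦ G_N(t;ζ)` satisfy `t > s + 1` (strict). From the hypotheses: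
`G_N(·;ζ) = 1` on `[1,2]` (D1), continuous on `[1,∞)` (D3), and for `2 < t ≤ N+1`,
`G_N'(t) = ζ G_{N-1}(t-1)/(t-1) = ζ G_N(t-1)/(t-1)` ((D5) and (D1): `I_N(t-1) = 0` as `t-1 ≤ N`, `N ≥ 2`;
`N = 1`: `G_1 ≡ 1`, no zeros). Then the method of steps: after a zero `s`, `G_N(·-1)` has one strict
sign on `(s, s+1)`, so by the mean value theorem `G_N` has the opposite strict sign on `(s, s+1]`
(induction over `⌈s⌉`; see triager r1-1's `IsDelaySolution.gap`). -/
theorem stub_gap :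
    ((∀ j : ℕ, 2 ≤ j → ∀ t : ℝ, t ≤ j → cellDensity j t = 0) ∧
      (∀ j : ℕ, 1 ≤ j → ∀ t : ℝ, (j : ℝ) < t → 0 < cellDensity j t) ∧
      (∀ j : ℕ, 2 ≤ j → Continuous (cellDensity j)) ∧
      (∀ j : ℕ, 1 ≤ j → ∀ t : ℝ, 2 < t →
        HasDerivAt (cellDensity (j + 1)) (cellDensity j (t - 1) / (t - 1)) t) ∧
      (∀ N : ℕ, ∀ ζ t : ℝ, 2 < t →
        HasDerivAt (modelG (N + 1) ζ) (ζ * modelG N ζ (t - 1) / (t - 1)) t)) →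
    ∀ N : ℕ, 1 ≤ N → ∀ ζ : ℝ, ζ < 0 → ∀ s t : ℝ, 1 ≤ s → s < t → t ≤ (N : ℝ) + 1 →
      modelG N ζ s = 0 → modelG N ζ t = 0 → s + 1 < t := by
  sorry

/-- STUB `stub_chain` (L, hardest) — the STURM CHAIN ALONG THE LADDER (continuity method in `u`):
from DELAY and GAP, for every integer `u ≥ 2` the limit cell polynomial `G(u;·) = modelG (u-1) · u`
(degree `u-2`, all coefficients `> 0`, `G(u;0) = 1`) takes strictly alternating signs at `u-1` strictly
decreasing real points — equivalently it has `u-2` simple negative zeros. Proof route (paper proof: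
TRIAGE-r1-1 appendix = evidence `model_simple_zeros_proof.md`; TRIAGE-r1-2 main finding): induction over
`m ≥ 2` of the invariant "on `u ∈ (m, m+1]`, `G_m(u;·)` and `G_{m-1}(u-1;·)` have real simple zeros,
strictly interlaced `z₁ > w₁ > z₂ > … > w_{m-2} > z_{m-1}`": base `(2,3]` explicit; open in `u`; closed
from the left because any equality in the weak limit chain is a common zero `ζ < 0` of `G_m(u;·)` and
`G_m(u-1;·)`, i.e. zeros of `t ↦ G_m(t;ζ)` at `u-1` and `u`, contradicting GAP with `N = m`; births at
`u = m⁺`: newborn zeros `Z ~ -I_{m-1}(m)/I_m(u)` of `G(u;·)` and `W ~ -I_{m-2}(m-1)/I_{m-1}(u-1)` of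
`G(u-1;·)` enter from `-∞` with `Z < W` (`I_m(m+δ) ≤ δ I_{m-1}(m-1+δ)/(m-1)`, `I_{m-1}` nondecreasing).
A root-free formulation of the invariant ("`2m-3` moving test points with alternating signs, nested")
avoids continuity-of-roots machinery. -/
theorem stub_chain :
    ((∀ j : ℕ, 2 ≤ j → ∀ t : ℝ, t ≤ j → cellDensity j t = 0) ∧
      (∀ j : ℕ, 1 ≤ j → ∀ t : ℝ, (j : ℝ) < t → 0 < cellDensity j t) ∧
      (∀ j : ℕ, 2 ≤ j → Continuous (cellDensity j)) ∧
      (∀ j : ℕ, 1 ≤ j → ∀ t : ℝ, 2 < t →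
        HasDerivAt (cellDensity (j + 1)) (cellDensity j (t - 1) / (t - 1)) t) ∧
      (∀ N : ℕ, ∀ ζ t : ℝ, 2 < t →
        HasDerivAt (modelG (N + 1) ζ) (ζ * modelG N ζ (t - 1) / (t - 1)) t)) →
    (∀ N : ℕ, 1 ≤ N → ∀ ζ : ℝ, ζ < 0 → ∀ s t : ℝ, 1 ≤ s → s < t → t ≤ (N : ℝ) + 1 →
      modelG N ζ s = 0 → modelG N ζ t = 0 → s + 1 < t) →
    ∀ u : ℕ, 2 ≤ u → ∃ q : Fin (u - 1) → ℝ, StrictAnti q ∧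
      ∀ i : Fin (u - 1), 0 < (-1 : ℝ) ^ (i : ℕ) * modelG (u - 1) (q i) u := by
  sorry

/-- STUB `stub_asymptotics` (L) — ALLADI'S CELL ASYMPTOTICS at fixed roughness: for integers
`1 ≤ j < u`, `A_j(x)·log x / x → I_j(u)` as `x → ∞` [Alladi 1982, Quart. J. Math. Oxford (2) 33,
129–148; Tenenbaum, Introduction…, III.6]. Provable now by induction on `j`: `j = 1` is
`π(x) − π(x^{1/u}) ~ x/log x` (PNT, in the tree); the step is Buchstab's identity `n = p·m`,
`p = P⁻(n) ∈ (x^{1/u}, x^{1/j}]`, `m` counted by the `(j-1)`-cell at roughness `log(x/p)/log p`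
(uniformity on compacts), Abel summation through `ϑ` — exactly the pattern of
`Literature.NumberTheory.Sieve.RoughNumbersBuchstabStep` / `exists_abs_card_roughIcc_sub_buchstab_le`
(the `Σ_j` version, Lichtman Lemma 6.1), with the substitution `t = x^{1/s}` turning `Σ_p` into
`∫ I_{j-1}(s-1) ds/(s-1) = I_j(u)`. -/
theorem stub_asymptotics :
    ∀ u : ℕ, 2 ≤ u → ∀ j : ℕ, 1 ≤ j → j < u →
      Tendsto (fun x : ℕ => (cell u x j : ℝ) * Real.log x / x) atTop (𝓝 (cellDensity j u)) := by
  sorry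

/-- STUB `stub_transfer` (M) — SIGN TRANSFER at finite `x` (pure algebra, no limits): if the reduced
real cell polynomial `Q_{u,x}` takes strictly alternating signs at `u-1` strictly decreasing real
points then `P_{u,x} = z·Q_{u,x}(z)` has only real zeros (`A_0(x) = 0`: `Ω(n) = 0 ⇒ n = 1`;
`A_u(x) = 0`: `P⁻(n)^{Ω(n)} ≤ n ≤ x`; `u-2` sign changes ⇒ `u-2 ≥ deg Q` distinct real roots by the
IVT ⇒ all complex roots real; `u = 2`: `Q = A_1(x) > 0` constant). The standing disprover's §F
(`cell_zero`, `cell_eq_zero_of_le`, `cellPoly_eq_mul_Q`, `realRootedAt_of_alternating`,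
`realRootedAt_of_natDegree_le_one`) is this statement up to indexing (`cellQ u x q =
(cellPolyQ u x).eval q`, increasing vs decreasing points). -/
theorem stub_transfer :
    ∀ u x : ℕ, 2 ≤ u → ∀ q : Fin (u - 1) → ℝ, StrictAnti q →
      (∀ i : Fin (u - 1), 0 < (-1 : ℝ) ^ (i : ℕ) * cellQ u x (q i)) → RealRootedAt u x := by
  sorry

/-! ## §2 Composition (sorry-free glue; kernel-checked) -/

/-- GLUE (proved): model alternation + cell asymptotics + sign transfer ⟹ the crux in factored form.
For each test point `q_i`, `(log x/x)·Q_{u,x}(q_i) = Σ_{j<u-1} (A_{j+1}(x) log x/x) q_i^j → G(u;q_i)`,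
so the strict model sign `(-1)^i G(u;q_i) > 0` holds for `Q_{u,x}` eventually in `x` (and `log x/x > 0`
for `x ≥ 2`); finitely many `i`, hence one `x₀(u)`; then TRANSFER at every `x ≥ x₀`. -/
theorem realRooted_of_stubs
    (hC : ∀ u : ℕ, 2 ≤ u → ∃ q : Fin (u - 1) → ℝ, StrictAnti q ∧
      ∀ i : Fin (u - 1), 0 < (-1 : ℝ) ^ (i : ℕ) * modelG (u - 1) (q i) u)
    (hA : ∀ u : ℕ, 2 ≤ u → ∀ j : ℕ, 1 ≤ j → j < u →
      Tendsto (fun x : ℕ => (cell u x j : ℝ) * Real.log x / x) atTop (𝓝 (cellDensity j u)))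
    (hT : ∀ u x : ℕ, 2 ≤ u → ∀ q : Fin (u - 1) → ℝ, StrictAnti q →
      (∀ i : Fin (u - 1), 0 < (-1 : ℝ) ^ (i : ℕ) * cellQ u x (q i)) → RealRootedAt u x) :
    ∀ u : ℕ, 2 ≤ u → ∃ x₀ : ℕ, ∀ x : ℕ, x₀ ≤ x → RealRootedAt u x := by
  intro u hu
  obtain ⟨q, hq, hsign⟩ := hC u hu
  -- the scaled finite-x polynomial converges to the model polynomial at each test point
  have hlim : ∀ i : Fin (u - 1), Tendsto (fun x : ℕ => Real.log x / x * cellQ u x (q i)) atTop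
      (𝓝 (modelG (u - 1) (q i) u)) := by
    intro i
    have h1 : ∀ x : ℕ, Real.log x / x * cellQ u x (q i)
        = ∑ j ∈ Finset.range (u - 1), ((cell u x (j + 1) : ℝ) * Real.log x / x) * (q i) ^ j := by
      intro x
      simp only [cellQ, Finset.mul_sum]
      refine Finset.sum_congr rfl fun j _ => ?_
      ring
    simp_rw [h1]
    unfold modelG
    refine tendsto_finsetSum _ fun j hj => ?_
    have hj' : j + 1 < u := by
      rw [Finset.mem_range] at hj
      omega
    exact (hA u hu (j + 1) (by omega) hj').mul_const _
  -- eventually (in x) every test-point sign is the model sign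
  have hev : ∀ i : Fin (u - 1), ∀ᶠ x : ℕ in atTop, 0 < (-1 : ℝ) ^ (i : ℕ) * cellQ u x (q i) := by
    intro i
    have hev1 : ∀ᶠ x : ℕ in atTop, 0 < (-1 : ℝ) ^ (i : ℕ) * (Real.log x / x * cellQ u x (q i)) :=
      ((hlim i).const_mul ((-1 : ℝ) ^ (i : ℕ))).eventually_const_lt (hsign i)
    filter_upwards [hev1, eventually_ge_atTop 2] with x h1 h2
    have hx : (0 : ℝ) < Real.log x / x := by
      apply div_pos
      · exact Real.log_pos (by exact_mod_cast (by omega : 1 < x))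
      · exact_mod_cast (by omega : 0 < x)
    have e : (-1 : ℝ) ^ (i : ℕ) * (Real.log x / x * cellQ u x (q i))
        = Real.log x / x * ((-1 : ℝ) ^ (i : ℕ) * cellQ u x (q i)) := by ring
    rw [e] at h1
    exact (mul_pos_iff_of_pos_left hx).mp h1
  obtain ⟨x₀, hx₀⟩ := eventually_atTop.mp (eventually_all.mpr hev)
  exact ⟨x₀, fun x hx => hT u x hu q hq (hx₀ x hx)⟩

/-- COMPOSITION: the five stubs imply the crux, concluded BY NAME. `stub_delay` feeds `stub_gap`
(GAP) and, with GAP, `stub_chain` (model alternation at every integer `u ≥ 2`); `realRooted_of_stubs`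
adds `stub_asymptotics` and `stub_transfer`; `crux_iff` (`Iff.rfl`, landed Negative file) renames. -/
theorem ModelHyperbolicity_of : ModelHyperbolicity :=
  crux_iff.mpr
    (realRooted_of_stubs (stub_chain stub_delay (stub_gap stub_delay)) stub_asymptotics stub_transfer)

end

end Summit.Parity.GeneralizedHardyLittlewood.Cruxes.ModelHyperbolicity.DelayLadderSturmChain
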